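import Literature.Analysis.Fourier.HilbertTransformLine
import Summits.NavierStokesRegularity.OSWSelfSimilar.SheetRowThirdExactFamily
import HarnessLib

/-!
# SHEET-ℝ, row `c_l = 1/3`: the two cited transform facts discharged — the exact family solves the row
# equation with the GENUINE Hilbert transform

HONEST FRAMING (cell ns-blowup, GROUP B «PROFILE SEARCH» zone Z3 / seat ns-blowup-selfsim; human rulings D-0035/D-0074):
**1-D MODEL (viscous generalised Constantin–Lax–Majda / Okamoto–Sakajo–Wunsch profile sheet on `ℝ`); not Euler, not
Navier–Stokes; «violates: none — MODEL».** Nothing in this file is a statement about Navier–Stokes.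

`SheetRowThirdExactFamily.lean` (ns-blowup-profile-eng-5, p430429) kernel-checks the ALGEBRA of the closed-form row
`c_l = 1/3` of the profile sheet `G(Ω; c_ω, c_l, a, ε) = c_ω Ω + c_l ξΩ′ + a 𝒰 Ω′ − (HΩ)Ω − εΩ″ = 0`, `𝒰′ = HΩ`, `𝒰(0) = 0`,
for the dilated double-pole ansatz `Ω_a(ξ) = −A f(ξ/ℓ)`, `f(x) = x/(1+x²)²`, and lists as «CITED, NOT PROVED» exactly two
transform facts: (T1) the closed form `hilbProfile` `(x²−1)/(2(1+x²)²)` IS the Hilbert transform of `profile` on `ℝ`;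
(T2) `H` commutes with positive dilations, so that `HΩ_a(ξ) = −A (Hf)(ξ/ℓ)`.
With the library operator `Literature.Analysis.Fourier.hilbertTransform` (p.v. symmetric form, convention `H sin = −cos`,
`u_x = Hω`) both are now theorems (`hilbertTransform_profile`, `hilbertTransform_dilatedProfile`), and the row statement is
assembled against the genuine operators: for `a ≠ 0`, `ℓ > 0`, `ℓ²(1−2a) = 9εa`, `A = 8/(3a)`, the functions
`Ω(η) = −A f(η/ℓ)` and `𝒰(η) = −Aℓ 𝒰_f(η/ℓ)` satisfy `𝒰(0) = 0`, `𝒰′ = HΩ` (H = `hilbertTransform`), and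
`Ω + (1/3) ξ Ω′ + a 𝒰 Ω′ − (HΩ) Ω − ε Ω″ = 0` at every `ξ ∈ ℝ` with `Ω′ = deriv Ω`, `Ω″ = deriv (deriv Ω)`
(`exactRow_solves_sheet_equation`). No `def`, no `Prop` hypothesis, no cited gap left on this row.
-/

namespace Summit.NavierStokesRegularity.OSWSelfSimilar
namespace SheetRowThirdExactFamily

open Literature.Analysis.Fourier

/-- (T1) DISCHARGED: the closed form `hilbProfile x = (x² − 1)/(2(1+x²)²)` IS the Hilbert transform of the double-pole profile
`profile x = x/(1+x²)²` (p.v. symmetric form, convention `H sin = −cos`).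
[cite: AmbroseLushnikovSiegelSilantyev2024, §5.2 (double-pole formulas for `ω` and `ℋω`)] -/
theorem hilbertTransform_profile (x : ℝ) : hilbertTransform profile x = hilbProfile x := by
  have h := hilbertTransform_div_one_add_sq_sq x
  unfold hilbProfile
  exact h

/-- (T2) DISCHARGED: for the dilated, scaled profile `Ω(η) = −A·f(η/ℓ)` (`ℓ > 0`), `HΩ(ξ) = −A·(Hf)(ξ/ℓ)` — the dilation rule
used in `rowResidual`. [cite: AmbroseLushnikovSiegelSilantyev2024, §5.2 (double-pole formulas, general width and amplitude)] -/
theorem hilbertTransform_dilatedProfile (A : ℝ) {ℓ : ℝ} (hℓ : 0 < ℓ) (ξ : ℝ) :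
    hilbertTransform (fun η => -A * profile (η / ℓ)) ξ = -A * hilbProfile (ξ / ℓ) := by
  have h := hilbertTransform_doublePole_dilate (-A) hℓ ξ
  unfold hilbProfile
  exact h

/-- First derivative of the dilated profile: `Ω′(ξ) = −(A/ℓ) f′(ξ/ℓ)`. [folklore] -/
theorem hasDerivAt_dilatedProfile (A : ℝ) {ℓ : ℝ} (hℓ : ℓ ≠ 0) (ξ : ℝ) :
    HasDerivAt (fun η => -A * profile (η / ℓ)) (-(A / ℓ) * dProfile (ξ / ℓ)) ξ := by
  have h := ((hasDerivAt_profile (ξ / ℓ)).comp ξ ((hasDerivAt_id' ξ).div_const ℓ)).const_mul (-A)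
  refine h.congr_deriv ?_
  field_simp

/-- Second derivative of the dilated profile: `Ω″(ξ) = −(A/ℓ²) f″(ξ/ℓ)`. [folklore] -/
theorem hasDerivAt_deriv_dilatedProfile (A : ℝ) {ℓ : ℝ} (hℓ : ℓ ≠ 0) (ξ : ℝ) :
    HasDerivAt (fun η => -(A / ℓ) * dProfile (η / ℓ)) (-(A / ℓ ^ 2) * ddProfile (ξ / ℓ)) ξ := by
  have h := ((hasDerivAt_dProfile (ξ / ℓ)).comp ξ ((hasDerivAt_id' ξ).div_const ℓ)).const_mul (-(A / ℓ))
  refine h.congr_deriv ?_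
  field_simp

/-- `deriv Ω = −(A/ℓ) f′(·/ℓ)` as functions. [folklore] -/
theorem deriv_dilatedProfile (A : ℝ) {ℓ : ℝ} (hℓ : ℓ ≠ 0) :
    deriv (fun η => -A * profile (η / ℓ)) = fun η => -(A / ℓ) * dProfile (η / ℓ) := by
  funext ξ
  exact (hasDerivAt_dilatedProfile A hℓ ξ).deriv

/-- `deriv (deriv Ω) ξ = −(A/ℓ²) f″(ξ/ℓ)`. [folklore] -/
theorem deriv_deriv_dilatedProfile (A : ℝ) {ℓ : ℝ} (hℓ : ℓ ≠ 0) (ξ : ℝ) :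
    deriv (deriv (fun η => -A * profile (η / ℓ))) ξ = -(A / ℓ ^ 2) * ddProfile (ξ / ℓ) := by
  rw [deriv_dilatedProfile A hℓ]
  exact (hasDerivAt_deriv_dilatedProfile A hℓ ξ).deriv

/-- The velocity primitive of the family: `𝒰(η) = −Aℓ·𝒰_f(η/ℓ)` has `𝒰′(ξ) = HΩ(ξ)` with the GENUINE Hilbert transform
(`ℓ > 0`), and `𝒰(0) = 0`. [folklore] -/
theorem hasDerivAt_dilatedPrim (A : ℝ) {ℓ : ℝ} (hℓ : 0 < ℓ) (ξ : ℝ) :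
    HasDerivAt (fun η => -A * ℓ * primProfile (η / ℓ)) (hilbertTransform (fun η => -A * profile (η / ℓ)) ξ) ξ := by
  have hℓ0 : ℓ ≠ 0 := hℓ.ne'
  have h := ((hasDerivAt_primProfile (ξ / ℓ)).comp ξ ((hasDerivAt_id' ξ).div_const ℓ)).const_mul (-A * ℓ)
  rw [hilbertTransform_dilatedProfile A hℓ ξ]
  refine h.congr_deriv ?_
  field_simp

/-- `𝒰(0) = 0` for the family. [folklore] -/
theorem dilatedPrim_zero (A ℓ : ℝ) : (fun η : ℝ => -A * ℓ * primProfile (η / ℓ)) 0 = 0 := by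
  simp [primProfile_zero]

/-- **THE EXACT ROW, END TO END (MODEL theorem, no cited gap):** for `a ≠ 0`, `ℓ > 0` with `ℓ²(1 − 2a) = 9εa` and
`A = 8/(3a)`, the functions `Ω(η) = −A·η/ℓ/(1+(η/ℓ)²)²` and `𝒰(η) = −Aℓ·𝒰_f(η/ℓ)` satisfy `𝒰(0) = 0`, `𝒰′ = HΩ` with the
genuine Hilbert transform on `ℝ`, and the `c_l = 1/3` row of the profile sheet
`Ω + (1/3) ξ Ω′ + a 𝒰 Ω′ − (HΩ) Ω − ε Ω″ = 0` at every `ξ ∈ ℝ` (`Ω′ = deriv Ω`, `Ω″ = deriv (deriv Ω)`). For `ε > 0`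
the width relation needs `0 < a < 1/2`; the row ends by delocalisation (`ℓ → ∞`) at `a = 1/2`
(`SheetRowThirdExactFamily.endpoint_relation`, `inviscid_edge`). WHAT THIS IS NOT: not NS — the row `c_l = 1/3` is the gCLM model
with time-dependent viscosity `ν(t) = ε(T−t)^{−1/3}`. [folklore] -/
theorem exactRow_solves_sheet_equation {a ε ℓ : ℝ} (ha : a ≠ 0) (hℓ : 0 < ℓ)
    (hwidth : ℓ ^ 2 * (1 - 2 * a) = 9 * ε * a) (Ω U : ℝ → ℝ)
    (hΩ : Ω = fun η => -(8 / (3 * a)) * profile (η / ℓ))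
    (hU : U = fun η => -(8 / (3 * a)) * ℓ * primProfile (η / ℓ)) :
    U 0 = 0 ∧ (∀ ξ, HasDerivAt U (hilbertTransform Ω ξ) ξ) ∧
      ∀ ξ, Ω ξ + (1 / 3) * ξ * deriv Ω ξ + a * U ξ * deriv Ω ξ - hilbertTransform Ω ξ * Ω ξ
        - ε * deriv (deriv Ω) ξ = 0 := by
  have hℓ0 : ℓ ≠ 0 := hℓ.ne'
  subst hΩ hU
  refine ⟨dilatedPrim_zero _ _, fun ξ => hasDerivAt_dilatedPrim _ hℓ ξ, fun ξ => ?_⟩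
  have hd1 : deriv (fun η => -(8 / (3 * a)) * profile (η / ℓ)) ξ = -(8 / (3 * a) / ℓ) * dProfile (ξ / ℓ) := by
    rw [deriv_dilatedProfile _ hℓ0]
  rw [hd1, deriv_deriv_dilatedProfile _ hℓ0 ξ, hilbertTransform_dilatedProfile _ hℓ ξ]
  have key := rowResidual_third_eq_zero ha hℓ0 hwidth (ξ / ℓ)
  unfold rowResidual at key
  have hx : ℓ * (ξ / ℓ) = ξ := by field_simp
  rw [hx] at key
  simp only
  linear_combination key

end SheetRowThirdExactFamily
end Summit.NavierStokesRegularity.OSWSelfSimilar
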